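import Summits.QuantumFields.BalabanUV.Beta.ChartConjugationRelative
import Summits.QuantumFields.BalabanUV.Beta.ChartConjugationEnd
import Summits.QuantumFields.BalabanUV.Beta.AxialDressingRootedHessian

/-!
# `BalabanUV.Beta.ChartConjugationRelativeEnd` — the reflection-covariance END over a RELATIVE inverse, and its instance for the
# axially DRESSED one-step family (β sub-cell, row BETA-an2, gen 12; items (iii′)/(iv′) of NOTE X-an2-41 §4)

HONEST FRAMING (cell contract, verbatim): «discharging `BetaPertH` makes Bałaban's UV stability UNCONDITIONAL — a real
constructive-QFT result; it is NOT the continuum limit and NOT the Clay problem.»  THIS MODULE mints no `Prop` fact and no `def`,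
cites nothing as a hypothesis, instantiates NO binder of the wall and DISCHARGES NOTHING of it: it re-states an5's `hR` ENDs
(`ChartConjugationReflection.axisReflectionCovariant_flip_hessKer_conj`, `ChartConjugationEnd.axisReflectionCovariant_flipK_hessKer_conj`)
with the two-sided sockets `comp K 𝕄 = idK = comp 𝕄 K` REPLACED by the relative ones (`ChartConjugationRelative.RelInv K 𝕄 E` + the
contact generators commuting with `E`), and instantiates the kernel slot for the axially dressed family through an2's dressed-kernel
identity `AxialDressingRooted.TbalOf_dressAt`.  Every remaining hypothesis is a BINDER.  NOT summit progress; NOT continuum; NOT Clay.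

ABSOLUTE RULE (cell, verbatim): «No internally-minted statement may enter as a cited fact. Every hypothesis is either
kernel-proved in this package or a verbatim quotation of a PUBLISHED theorem with page reference. The manuscript(s) under
audit are NOT citable for their own disputed steps — they are the thing under adjudication; programme-internal
(2001/route/tribunal) claims are never citable.»  Every theorem below is kernel-proved from explicit, abstract hypotheses.

CONTENT.
* §1 (generic fibre) `hess_refl_conj_rel`, `hessKer_refl_conj_rel`, **`axisReflectionCovariant_flip_hessKer_conj_rel`** — an5's three
  with `(hAM, hMA) ↦ (hE, hR : RelInv A 𝕄 E)` and the commutations `E∘X_{μy} = X_{μy}∘E`, `E∘X₂ = X₂∘E` of the contact letters.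
* §2 (packed fibre) `comp_vertexOfK_comm` (fine commutation `E∘C_{κ′u} = C_{κ′u}∘E` ⇒ coarse commutation of `vertexOfK K N C μ y`, by
  an5's exchange lemmas), **`axisReflectionCovariant_flipK_hessKer_conj_rel`** (sockets (St), (Wt), (Sr-conj), (Wr-conj) VERBATIM as in
  an5's END; kernel-side: `K` decaying, block-translation and reflection invariant; inverse-side: `RelInv K 𝕄 E`, `E` spread).
* §3 THE DRESSED FAMILY: **`axisReflectionCovariant_flipK_TbalOf_dressAt_rel`** — for UNDRESSED step jets `Js⁰` and the dressed family
  `fun j ↦ dressAt hr (Js⁰ j)` (the shape of `SpineRooted.JsBalAtOf`): per step `j`, with `G_j := coDressKAt (toSite r) Lc (KInvStep Lc j)`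
  (decay and block covariance are THEOREMS, `AxialDressingRooted.decays_/shiftK_coDressKAt_KInvStep`), the BINDERS are: reflection
  invariance `refK (Φ Lc α) G_j = G_j` (item (ii-2a)), a spread `𝕄 j` and a spread `E` with `RelInv G_j (𝕄 j) E` (item (ii-1)), contact
  families commuting with `E`, and the six jet laws of the UNDRESSED jets — then `∀ j, AxisReflectionCovariant (flipK (TbalOf Lc (dressAt hr ∘ Js⁰) j))`,
  the `hR` binder of `OneStepKernelFamily.d1Drift_of_D1Tel_D1Rep` for the wall family v2.22.
-/

open Finset
open scoped BigOperators
open Literature.MathematicalPhysics.QuantumFieldTheory.Balaban1983to89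
open Literature.MathematicalPhysics.QuantumFieldTheory.Balaban1983to89.Beta
open B12Sec2to5 (l1 l1_nonneg)
open ExpKernelCalculus (MKer Decays BiLoc comp tr bubble tadpole hess hessKer hess_eq_hessKer BlockCovariant VertexFamily VertexFamily₂)
open PolarizationSign (axisReflect axisReflect_apply reflSign AxisReflectionCovariant)
open KernelReflection (LegMap refK refK_apply bondRefl bondRefl_sub comp_refK tr_refK tadpole_smul bubble_smul_left bubble_smul_right)
open KernelWard (comp_finset_sum_right comp_finset_sum_left)
open AffineAveraging (box toSite)
open OneStepResolventKernel (Fib wsum LocStencil JetData)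
open OneStepKernelFamily (KInvStep decays_KInvStep shiftK_KInvStep colH vertexOfK vertexFamily_vertexOfK' TstepOf TbalOf flipK)
open ResolventReflection (bref bref_eq_bondRefl Φ refK_KInvStep vertexOfK_translate_block)
open Summit.QuantumFields.BalabanUV.Beta.TameKernelCalculus
open Summit.QuantumFields.BalabanUV.Beta.ChartConjugation
open Summit.QuantumFields.BalabanUV.Beta.ChartConjugationReflection
open Summit.QuantumFields.BalabanUV.Beta.ChartConjugationRelative
open Summit.QuantumFields.BalabanUV.Beta.AxialDressingRooted (dressAt coDressKAt TbalOf_dressAt decays_coDressKAt_KInvStep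
  shiftK_coDressKAt_KInvStep)

namespace Summit.QuantumFields.BalabanUV.Beta.ChartConjugationRelativeEnd

noncomputable section

/-! ## §1 Covariance of the resolvent Hessian under a symmetry with conjugated vertex laws — relative inverse -/

section General

variable {D : ℕ} {F : Type*} [Fintype F]

/-- **COVARIANCE OF THE RESOLVENT HESSIAN, CONJUGATED VERTEX LAWS, RELATIVE INVERSE** (`ChartConjugationReflection.hess_refl_conj`
with `RelInv A 𝕄 E` in place of the two-sided sockets; the contact letters commute with `E`). -/
theorem hess_refl_conj_rel (Φ : LegMap D F) {A M E : MKer D F} {V : Fin D → (Fin D → ℤ) → MKer D F}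
    {W : Fin D → (Fin D → ℤ) → Fin D → (Fin D → ℤ) → MKer D F} (hA : Spr A) (hM : Spr M) (hE : Spr E) (hR : RelInv A M E)
    (hAr : refK Φ A = A) (hV : ∀ μ y, Loc (V μ y)) (hW : ∀ μ y ν y', Loc (W μ y ν y'))
    (ρ : Fin D → (Fin D → ℤ) → (Fin D → ℤ)) (σ : Fin D → ℝ) {X : Fin D → (Fin D → ℤ) → MKer D F}
    {X₂ : Fin D → (Fin D → ℤ) → Fin D → (Fin D → ℤ) → MKer D F} (hX : ∀ μ y, Loc (X μ y)) (hX₂ : ∀ μ y ν y', Loc (X₂ μ y ν y'))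
    (hEX : ∀ μ y, comp E (X μ y) = comp (X μ y) E) (hEX₂ : ∀ μ y ν y', comp E (X₂ μ y ν y') = comp (X₂ μ y ν y') E)
    (hVr : ∀ μ y, V μ (ρ μ y) = σ μ • refK Φ (V μ y + conjV M (X μ y)))
    (hWr : ∀ μ y ν y', W μ (ρ μ y) ν (ρ ν y') =
      (σ μ * σ ν) • refK Φ (W μ y ν y' + conjW M (V μ y) (V ν y') (X μ y) (X ν y') (X₂ μ y ν y')))
    (μ : Fin D) (y : Fin D → ℤ) (ν : Fin D) (y' : Fin D → ℤ) :
    hess A V W μ (ρ μ y) ν (ρ ν y') = σ μ * σ ν * hess A V W μ y ν y' := by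
  have key := hess_conj_invariant_rel hA hM hE hR (hV μ y) (hV ν y') (hW μ y ν y') (hX μ y) (hX ν y') (hX₂ μ y ν y')
    (hEX μ y) (hEX ν y') (hEX₂ μ y ν y')
  have hW' : Loc (W μ y ν y' + conjW M (V μ y) (V ν y') (X μ y) (X ν y') (X₂ μ y ν y')) :=
    (hW μ y ν y').add (loc_conjW hM (hV μ y) (hV ν y') (hX μ y) (hX ν y') (hX₂ μ y ν y'))
  have hV₁ : Loc (V μ y + conjV M (X μ y)) := (hV μ y).add (loc_conjV hM (hX μ y))
  have hV₂ : Loc (V ν y' + conjV M (X ν y')) := (hV ν y').add (loc_conjV hM (hX ν y'))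
  unfold ExpKernelCalculus.hess
  rw [hWr, hVr, hVr, tadpole_smul, bubble_smul_left, bubble_smul_right]
  conv_lhs => rw [← hAr]
  rw [tadpole_refK_loc Φ hA hW', bubble_refK_loc Φ hA hV₁ hV₂]
  linear_combination (σ μ * σ ν) * key

open B6BondElimination (unitVec unitVec_apply) in
/-- **THE DIFFERENCE-VARIABLE LAW, CONJUGATED VERTEX LAWS, RELATIVE INVERSE** (`ChartConjugationReflection.hessKer_refl_conj` twin). -/
theorem hessKer_refl_conj_rel (Φ : LegMap D F) {A M E : MKer D F} {V : Fin D → (Fin D → ℤ) → MKer D F}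
    {W : Fin D → (Fin D → ℤ) → Fin D → (Fin D → ℤ) → MKer D F} {N : ℕ} (hA : Spr A) (hM : Spr M) (hE : Spr E)
    (hR : RelInv A M E) (hcov : BlockCovariant A V W N) (hAr : refK Φ A = A) (hV : ∀ μ y, Loc (V μ y))
    (hW : ∀ μ y ν y', Loc (W μ y ν y')) (α : Fin D) (c : ℤ) {X : Fin D → (Fin D → ℤ) → MKer D F}
    {X₂ : Fin D → (Fin D → ℤ) → Fin D → (Fin D → ℤ) → MKer D F} (hX : ∀ μ y, Loc (X μ y)) (hX₂ : ∀ μ y ν y', Loc (X₂ μ y ν y'))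
    (hEX : ∀ μ y, comp E (X μ y) = comp (X μ y) E) (hEX₂ : ∀ μ y ν y', comp E (X₂ μ y ν y') = comp (X₂ μ y ν y') E)
    (hVr : ∀ μ y, V μ (bondRefl α c μ y) = reflSign α μ • refK Φ (V μ y + conjV M (X μ y)))
    (hWr : ∀ μ y ν y', W μ (bondRefl α c μ y) ν (bondRefl α c ν y') =
      (reflSign α μ * reflSign α ν) • refK Φ (W μ y ν y' + conjW M (V μ y) (V ν y') (X μ y) (X ν y') (X₂ μ y ν y')))
    (μ ν : Fin D) (z : Fin D → ℤ) :
    hessKer A V W μ ν (axisReflect α z + (if μ = α then unitVec α else 0) - (if ν = α then unitVec α else 0))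
      = reflSign α μ * reflSign α ν * hessKer A V W μ ν z := by
  have h := hess_refl_conj_rel Φ hA hM hE hR hAr hV hW (bondRefl α c) (reflSign α) hX hX₂ hEX hEX₂ hVr hWr μ 0 ν z
  rw [hess_eq_hessKer hcov, hess_eq_hessKer hcov, sub_zero, bondRefl_sub, sub_zero] at h
  exact h

open B6BondElimination (unitVec unitVec_apply) in
/-- **`AxisReflectionCovariant` OF THE FLIPPED KERNEL FROM THE CONJUGATED VERTEX LAWS, RELATIVE INVERSE**
(`ChartConjugationReflection.axisReflectionCovariant_flip_hessKer_conj` twin): per axis, a leg map fixing `A`, an offset, localised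
contact families `X`, `X₂` COMMUTING WITH `E`, and (Sr-conj)/(Wr-conj). -/
theorem axisReflectionCovariant_flip_hessKer_conj_rel {A M E : MKer D F} {V : Fin D → (Fin D → ℤ) → MKer D F}
    {W : Fin D → (Fin D → ℤ) → Fin D → (Fin D → ℤ) → MKer D F} {N : ℕ} (hA : Spr A) (hM : Spr M) (hE : Spr E)
    (hR : RelInv A M E) (hcov : BlockCovariant A V W N) (hV : ∀ μ y, Loc (V μ y)) (hW : ∀ μ y ν y', Loc (W μ y ν y'))
    (hAr : ∀ α : Fin D, ∃ Φα : LegMap D F, refK Φα A = A ∧ ∃ (c : ℤ) (X : Fin D → (Fin D → ℤ) → MKer D F)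
      (X₂ : Fin D → (Fin D → ℤ) → Fin D → (Fin D → ℤ) → MKer D F), (∀ μ y, Loc (X μ y)) ∧ (∀ μ y ν y', Loc (X₂ μ y ν y')) ∧
      (∀ μ y, comp E (X μ y) = comp (X μ y) E) ∧ (∀ μ y ν y', comp E (X₂ μ y ν y') = comp (X₂ μ y ν y') E) ∧
      (∀ μ y, V μ (bondRefl α c μ y) = reflSign α μ • refK Φα (V μ y + conjV M (X μ y))) ∧
      (∀ μ y ν y', W μ (bondRefl α c μ y) ν (bondRefl α c ν y') =
        (reflSign α μ * reflSign α ν) • refK Φα (W μ y ν y' + conjW M (V μ y) (V ν y') (X μ y) (X ν y') (X₂ μ y ν y')))) :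
    AxisReflectionCovariant (fun μ ν z => hessKer A V W μ ν (-z)) := by
  intro α μ ν z
  obtain ⟨Φα, hA', c, X, X₂, hX, hX₂, hEX, hEX₂, hVr, hWr⟩ := hAr α
  have h := hessKer_refl_conj_rel Φα hA hM hE hR hcov hA' hV hW α c hX hX₂ hEX hEX₂ hVr hWr μ ν (-z)
  have e : -(axisReflect α z - (if μ = α then unitVec α else 0) + (if ν = α then unitVec α else 0))
      = axisReflect α (-z) + (if μ = α then unitVec α else 0) - (if ν = α then unitVec α else 0) := by
    funext i
    simp only [Pi.neg_apply, Pi.sub_apply, Pi.add_apply, axisReflect_apply]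
    by_cases hi : i = α <;> by_cases hμ : μ = α <;> by_cases hν : ν = α <;> simp [hi, hμ, hν, unitVec_apply] <;> ring
  show hessKer A V W μ ν (-(axisReflect α z - (if μ = α then unitVec α else 0) + (if ν = α then unitVec α else 0)))
    = reflSign α μ * reflSign α ν * hessKer A V W μ ν (-z)
  rw [e]
  exact h

end General

/-! ## §2 The packed level: coarse commutation and the `hR` END over the relative sockets -/

section Packed

variable {d N : ℕ}

/-- **FINE COMMUTATION ⇒ COARSE COMMUTATION**: if `E` commutes with every member of a local contact-generator family `C`, it commutes
with the chain-rule vertex `vertexOfK K N C μ y` (an5's exchange lemmas `comp_wsum` / `wsum_comp`). -/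
theorem comp_vertexOfK_comm {K E : MKer (d + 1) (Fib d)} (hK : ∃ δ C : ℝ, 0 < δ ∧ 0 ≤ C ∧ Decays K C δ) (hE : Spr E)
    {C : Fin (d + 1) → (Fin (d + 1) → ℤ) → MKer (d + 1) (Fib d)} {Cc δc : ℝ} (hC : LocStencil C Cc δc) (hδc : 0 < δc)
    (hEC : ∀ κ' u, comp E (C κ' u) = comp (C κ' u) E) (μ : Fin (d + 1)) (y : Fin (d + 1) → ℤ) :
    comp E (vertexOfK K N C μ y) = comp (vertexOfK K N C μ y) E := by
  have hB : ∀ κ' u x z a b, |C κ' u x z a b| ≤ Cc := abs_le_of_locStencil hC hδc.le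
  have hCc : 0 ≤ Cc := (hC 0 0).nonneg (Sum.inl 0)
  have hWl : ∀ κ', Loc (wsum (colH K N μ y κ') (C κ')) := fun κ' => loc_wsum_colH (N := N) hK hC hδc μ y κ'
  rw [vertexOfK_eq_sum,
    comp_finset_sum_right Finset.univ (fun κ' _ x z a b => slices_tame hE.tame (hWl κ').tame x z a b),
    comp_finset_sum_left Finset.univ (fun κ' _ x z a b => slices_tame (hWl κ').tame hE.tame x z a b)]
  refine Finset.sum_congr rfl fun κ' _ => ?_
  rw [comp_wsum hE (summable_abs_colH (N := N) hK μ y κ') hCc (hB κ'),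
    wsum_comp hE (summable_abs_colH (N := N) hK μ y κ') hCc (hB κ')]
  congr 1
  funext u
  exact hEC κ' u

/-- **THE TYPED REFLECTION LAW OF A RESOLVENT HESSIAN KERNEL FROM CONJUGATED JET COVARIANCE — RELATIVE INVERSE.**
`ChartConjugationEnd.axisReflectionCovariant_flipK_hessKer_conj` with the sockets `comp K 𝕄 = idK`, `comp 𝕄 K = idK` replaced by a spread
`E` and `RelInv K 𝕄 E` (BINDERS) and the contact generators `C α κ′ u`, second-order contacts `X₂ α …` commuting with `E` (BINDERS); the
jet laws (St), (Wt), (Sr-conj), (Wr-conj) VERBATIM.  All covariances and inverse rules are HYPOTHESES, never facts. -/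
theorem axisReflectionCovariant_flipK_hessKer_conj_rel {K M E : MKer (d + 1) (Fib d)}
    (hKd : ∃ δ C : ℝ, 0 < δ ∧ 0 ≤ C ∧ Decays K C δ) (hKs : ∀ t : Fin (d + 1) → ℤ, ExpKernelCalculus.shiftK (-((N : ℤ) • t)) K = K)
    (hKr : ∀ α : Fin (d + 1), refK (Φ N α) K = K) (hM : Spr M) (hE : Spr E) (hR : RelInv K M E) (J : JetData d N)
    (hSt : ∀ (κ' : Fin (d + 1)) (u t : Fin (d + 1) → ℤ), J.S κ' (u + (N : ℤ) • t) = ExpKernelCalculus.shiftK (-((N : ℤ) • t)) (J.S κ' u))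
    (hWt : ∀ (μ : Fin (d + 1)) (y : Fin (d + 1) → ℤ) (ν : Fin (d + 1)) (y' t : Fin (d + 1) → ℤ),
      J.W μ (y + t) ν (y' + t) = ExpKernelCalculus.shiftK (-((N : ℤ) • t)) (J.W μ y ν y'))
    (C : Fin (d + 1) → Fin (d + 1) → (Fin (d + 1) → ℤ) → MKer (d + 1) (Fib d)) {Cc δc : ℝ} (hC : ∀ α, LocStencil (C α) Cc δc)
    (hδc : 0 < δc) (X₂ : Fin (d + 1) → Fin (d + 1) → (Fin (d + 1) → ℤ) → Fin (d + 1) → (Fin (d + 1) → ℤ) → MKer (d + 1) (Fib d))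
    (hX₂ : ∀ α μ y ν y', Loc (X₂ α μ y ν y'))
    (hEC : ∀ α κ' u, comp E (C α κ' u) = comp (C α κ' u) E)
    (hEX₂ : ∀ α μ y ν y', comp E (X₂ α μ y ν y') = comp (X₂ α μ y ν y') E)
    (hSrC : ∀ (α κ' : Fin (d + 1)) (u : Fin (d + 1) → ℤ),
      J.S κ' (bref α κ' u) = reflSign α κ' • refK (Φ N α) (J.S κ' u + conjV M (C α κ' u)))
    (hWrC : ∀ (α μ : Fin (d + 1)) (y : Fin (d + 1) → ℤ) (ν : Fin (d + 1)) (y' : Fin (d + 1) → ℤ),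
      J.W μ (bref α μ y) ν (bref α ν y') = (reflSign α μ * reflSign α ν) • refK (Φ N α) (J.W μ y ν y' +
        conjW M (vertexOfK K N J.S μ y) (vertexOfK K N J.S ν y') (vertexOfK K N (C α) μ y) (vertexOfK K N (C α) ν y')
          (X₂ α μ y ν y'))) :
    AxisReflectionCovariant (flipK (hessKer K (vertexOfK K N J.S) J.W)) := by
  obtain ⟨Cv, δv, hδv, hV⟩ := vertexFamily_vertexOfK' (N := N) hKd J.loc J.δ_pos
  have hKspr : Spr K := by obtain ⟨δK, CK, hδK, _, hK⟩ := hKd; exact ⟨CK, δK, hδK, hK⟩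
  have hVl : ∀ μ y, Loc (vertexOfK K N J.S μ y) := fun μ y => ⟨_, _, Cv, δv, hδv, hV μ y⟩
  have hWl : ∀ μ y ν y', Loc (J.W μ y ν y') := fun μ y ν y' => ⟨_, _, J.Cw, J.δ, J.δ_pos, J.loc₂ μ y ν y'⟩
  have hcov : BlockCovariant K (vertexOfK K N J.S) J.W N := ⟨hKs, vertexOfK_translate_block hKs hSt, hWt⟩
  refine axisReflectionCovariant_flip_hessKer_conj_rel hKspr hM hE hR hcov hVl hWl fun α => ⟨Φ N α, hKr α, 1, vertexOfK K N (C α),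
    X₂ α, fun μ y => ?_, hX₂ α, fun μ y => ?_, hEX₂ α, fun μ y => ?_, fun μ y ν y' => ?_⟩
  · obtain ⟨Cx, δx, hδx, hXv⟩ := vertexFamily_vertexOfK' (N := N) hKd (hC α) hδc
    exact ⟨_, _, Cx, δx, hδx, hXv μ y⟩
  · exact comp_vertexOfK_comm hKd hE (hC α) hδc (hEC α) μ y
  · rw [← bref_eq_bondRefl]
    exact vertexOfK_reflect_conj (hKr α) hKd hM J.loc J.δ_pos (hC α) hδc (hSrC α) μ y
  · rw [← bref_eq_bondRefl, ← bref_eq_bondRefl]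
    exact hWrC α μ y ν y'

end Packed

/-! ## §3 The END for the axially DRESSED one-step family (dimension four) -/

section Dressed

/-- **THE `hR` BINDER FOR THE DRESSED WALL FAMILY, OVER THE RELATIVE SOCKETS.**  Let `Js⁰ : ℕ → JetData 3 Lc` be UNDRESSED step jets
and `r` an in-block root; the dressed family is `fun j ↦ dressAt hr (Js⁰ j)` (the shape of `SpineRooted.JsBalAtOf`, whose members are
`dressAt hr ∘ JsBal0AtOf …` by `rfl`).  Per step `j` put `G_j := coDressKAt (toSite r) Lc (KInvStep Lc j)` (`= Π_ρ · KInvStep_j · Πᵀ_ρ`;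
its decay and block covariance are theorems).  BINDERS: reflection invariance `refK (Φ Lc α) G_j = G_j` (item (ii-2a); centred root,
odd `Lc`), spread `𝕄 j` and `E` with `RelInv G_j (𝕄 j) E` (item (ii-1): `G_j` inverts the undressed bordered step Hessian on the range
of the axial coordinate projector), contact families `C j α`, second-order contacts `X₂ j α` commuting with `E`, and the six jet laws
(St), (Wt), (Sr-conj), (Wr-conj) of the UNDRESSED jets against `𝕄 j` (item (ii-2)/(ii-3)).  CONCLUSION:
`∀ j, AxisReflectionCovariant (flipK (TbalOf Lc (fun j ↦ dressAt hr (Js⁰ j)) j))` — the `hR` hypothesis of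
`OneStepKernelFamily.d1Drift_of_D1Tel_D1Rep` for the dressed family.  Proof: `TbalOf_dressAt` + §2.  Discharges nothing by itself. -/
theorem axisReflectionCovariant_flipK_TbalOf_dressAt_rel {Lc : ℕ} [NeZero Lc] {r : Fin 4 → ℕ} (hr : r ∈ box 4 Lc)
    (Js : ℕ → JetData 3 Lc) (M : ℕ → MKer 4 (Fib 3)) (E : MKer 4 (Fib 3))
    (hGr : ∀ (j : ℕ) (α : Fin 4), refK (Φ Lc α) (coDressKAt (toSite r) Lc (KInvStep (d := 3) Lc j)) =
      coDressKAt (toSite r) Lc (KInvStep (d := 3) Lc j))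
    (hM : ∀ j, Spr (M j)) (hE : Spr E) (hR : ∀ j, RelInv (coDressKAt (toSite r) Lc (KInvStep (d := 3) Lc j)) (M j) E)
    (hSt : ∀ (j : ℕ) (κ' : Fin 4) (u t : Fin 4 → ℤ), (Js j).S κ' (u + (Lc : ℤ) • t) = ExpKernelCalculus.shiftK (-((Lc : ℤ) • t)) ((Js j).S κ' u))
    (hWt : ∀ (j : ℕ) (μ : Fin 4) (y : Fin 4 → ℤ) (ν : Fin 4) (y' t : Fin 4 → ℤ),
      (Js j).W μ (y + t) ν (y' + t) = ExpKernelCalculus.shiftK (-((Lc : ℤ) • t)) ((Js j).W μ y ν y'))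
    (C : ℕ → Fin 4 → Fin 4 → (Fin 4 → ℤ) → MKer 4 (Fib 3)) (Cc δc : ℕ → ℝ) (hC : ∀ j α, LocStencil (C j α) (Cc j) (δc j))
    (hδc : ∀ j, 0 < δc j) (X₂ : ℕ → Fin 4 → Fin 4 → (Fin 4 → ℤ) → Fin 4 → (Fin 4 → ℤ) → MKer 4 (Fib 3))
    (hX₂ : ∀ j α μ y ν y', Loc (X₂ j α μ y ν y'))
    (hEC : ∀ j α κ' u, comp E (C j α κ' u) = comp (C j α κ' u) E)
    (hEX₂ : ∀ j α μ y ν y', comp E (X₂ j α μ y ν y') = comp (X₂ j α μ y ν y') E)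
    (hSrC : ∀ (j : ℕ) (α κ' : Fin 4) (u : Fin 4 → ℤ),
      (Js j).S κ' (bref α κ' u) = reflSign α κ' • refK (Φ Lc α) ((Js j).S κ' u + conjV (M j) (C j α κ' u)))
    (hWrC : ∀ (j : ℕ) (α μ : Fin 4) (y : Fin 4 → ℤ) (ν : Fin 4) (y' : Fin 4 → ℤ),
      (Js j).W μ (bref α μ y) ν (bref α ν y') = (reflSign α μ * reflSign α ν) • refK (Φ Lc α) ((Js j).W μ y ν y' +
        conjW (M j) (vertexOfK (coDressKAt (toSite r) Lc (KInvStep (d := 3) Lc j)) Lc (Js j).S μ y)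
          (vertexOfK (coDressKAt (toSite r) Lc (KInvStep (d := 3) Lc j)) Lc (Js j).S ν y')
          (vertexOfK (coDressKAt (toSite r) Lc (KInvStep (d := 3) Lc j)) Lc (C j α) μ y)
          (vertexOfK (coDressKAt (toSite r) Lc (KInvStep (d := 3) Lc j)) Lc (C j α) ν y') (X₂ j α μ y ν y'))) :
    ∀ j : ℕ, AxisReflectionCovariant (flipK (TbalOf Lc (fun j => dressAt hr (Js j)) j)) := by
  intro j
  rw [TbalOf_dressAt hr Js j]
  exact axisReflectionCovariant_flipK_hessKer_conj_rel (decays_coDressKAt_KInvStep hr j)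
    (shiftK_coDressKAt_KInvStep (toSite r) j) (hGr j) (hM j) hE (hR j) (Js j) (hSt j) (hWt j) (C j) (hC j) (hδc j) (X₂ j)
    (hX₂ j) (hEC j) (hEX₂ j) (hSrC j) (hWrC j)

end Dressed

end

end Summit.QuantumFields.BalabanUV.Beta.ChartConjugationRelativeEnd
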